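import Summits.QuantumAdvantage.QuantumAdvantage.Theorems.ArithStatLadderIqThreeNotPPolyStubApSieve
import Summits.QuantumAdvantage.QuantumAdvantage.Theorems.ArithStatLadderIqThreeNotPPolyStubFundDensityAP
import Literature.Computability.Complexity.StackArith

/-!
# Stub `stub_fundDensityNG` of line `Sketch` (v4) for the crux `ArithStatLadder.IqThreeNotPPoly`

YES-density of the planted Nagell family. For a squarefree modulus `N` of bit length `n ≥ 10` and a
seed `k < K := 2^(8n+48)` put `c = 1 + 2³⁰N⁵`, `s = 1 + 6cNk` and `d = N s (4c³ − N s)`. At least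
a quarter of the seeds make `−d` a negative fundamental discriminant. The squarefree sieve in an
arithmetic progression is the landed stub `stub_apSieve`; the covering/counting helpers
`fundAP_le_card_add`, `fundAP_five_le` are those of the sibling stub `stub_fundDensityAP`.

Mathematics (`c` is odd, `c ≡ 1 (mod N)`, `c³ ≡ c ≡ 1 + N (mod 3)`; `s` is odd, `≡ 1 (mod N)` and
`≡ 1 (mod c)`).
* No truncation: `2^(n−1) ≤ N < 2^n` gives `K ≤ 2⁵⁶N⁸`, so `16·6cN²K ≤ 6c·(2³⁰N⁵)² ≤ 6c³` and
  `N + 6cN²K ≤ c³/2`; hence `4c³ − N s ≥ 1` for all `k < K`.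
* Odd `N`: if `s` and `w := 4c³ − N s` are squarefree then `d = (N s)·w` is squarefree
  (`gcd(Ns, w) = gcd(Ns, 4c³) = 1`) and `d ≡ −(Ns)² ≡ 3 (mod 4)`: first branch.
* Even `N = 2M` (`M` odd squarefree): `d = 4·(M s)(2c³ − M s)`; if `s` and `w' := 2c³ − M s` are
  squarefree then `f = (M s) w'` is squarefree and `f ≡ 2c³(Ms) − (Ms)² ≡ 2 − 1 = 1 (mod 4)`
  (`c`, `Ms` odd), so `(−d)/4 = −f ≡ 3 (mod 4)`: second branch.
* Counting: `K ≤ good + bad_s + bad_w`; sieve at `(1, 6cN, 5)`: `4·bad_s ≤ K + 4√(1 + 6cNK)`; the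
  decreasing progression `w(k) = (4c³ − N) − 6cN²·k` is reflected (`k ↦ K − 1 − k`) into
  `a₂ + 6cN²·k'`, `gcd(a₂, 6cN²) = gcd(4c³ − N, 6cN²) = 1` (resp. `a₂ + 12cM²·k'`), and the sieve
  at `p₀ = 5` gives `4·bad_w ≤ K + 4√(a₂ + q₂K)`, `a₂ + q₂K ≤ 5c³`. With `c ≤ 2^(5n+30)`:
  `4√(1 + 6cNK) ≤ 2^(7n+43) ≤ X := 2^(8n+44) = K/16`, `√(5c³) ≤ X` (`n ≥ 5`), so
  `4·good ≥ 4K − (K + X) − (K + 4X) = 27X ≥ K`.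
-/

set_option linter.dupNamespace false -- D-0017: single-problem summit ⇒ `QuantumAdvantage.QuantumAdvantage` by design

namespace Summit.QuantumAdvantage.QuantumAdvantage.Theorems.IqThreeNotPPoly

open scoped Classical
open Finset
open _root_.Computability
open Literature.Computability.Cryptography (IsNegFundamentalDiscr)
open Literature.Computability.Complexity (norm_encodeNat length_norm bitsToNat_encodeNat)

/-! ## The two branches of `IsNegFundamentalDiscr` -/

/-- A squarefree `d ≡ 3 (mod 4)` gives the negative fundamental discriminant `−d` (first branch:
`−d ≡ 1 (mod 4)`, squarefree, `≠ 1`). -/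
theorem fundNG_fund_of_mod_four {d : ℕ} (hd : Squarefree d) (h3 : d % 4 = 3) :
    IsNegFundamentalDiscr d := by
  left
  refine ⟨by omega, ?_, by omega⟩
  rw [← Int.squarefree_natAbs, Int.natAbs_neg, Int.natAbs_natCast]
  exact hd

/-- A squarefree `f ≡ 1 (mod 4)` gives the negative fundamental discriminant `−4f` (second branch:
`4 ∣ −4f`, `(−4f)/4 = −f ≡ 3 (mod 4)`, squarefree). -/
theorem fundNG_fund_four_mul {f : ℕ} (hf : Squarefree f) (h1 : f % 4 = 1) :
    IsNegFundamentalDiscr (4 * f) := by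
  right
  have e : (-((4 * f : ℕ) : ℤ)) / 4 = -(f : ℤ) := by push_cast; omega
  refine ⟨by push_cast; omega, by rw [e]; omega, ?_⟩
  rw [e, ← Int.squarefree_natAbs, Int.natAbs_neg, Int.natAbs_natCast]
  exact hf

/-! ## Sufficient conditions for fundamentality -/

/-- Odd core: `m` odd, squarefree, coprime to `c`, and `4c³ − m` squarefree ⇒ `−m(4c³ − m)` is a
negative fundamental discriminant (`gcd(m, 4c³ − m) = gcd(m, 4c³) = 1`, so `m(4c³ − m)` is
squarefree, and `m(4c³ − m) = 4c³m − m² ≡ 3 (mod 4)`). -/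
theorem fundNG_core_odd {m c : ℕ} (hm2 : m % 2 = 1) (hm : Squarefree m) (hmc : Nat.Coprime m c)
    (hw : Squarefree (4 * c ^ 3 - m)) : IsNegFundamentalDiscr (m * (4 * c ^ 3 - m)) := by
  have hle : m ≤ 4 * c ^ 3 := by
    by_contra h
    rw [Nat.sub_eq_zero_of_le (by omega)] at hw
    exact not_squarefree_zero hw
  have hcop : Nat.Coprime m (4 * c ^ 3 - m) := by
    rw [Nat.coprime_sub_self_right hle, show 4 * c ^ 3 = 2 * 2 * c ^ 3 by ring]
    have h2 : Nat.Coprime m 2 := ((Nat.Prime.coprime_iff_not_dvd Nat.prime_two).2 (by omega)).symm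
    exact (h2.mul_right h2).mul_right (hmc.pow_right 3)
  have hsq : Squarefree (m * (4 * c ^ 3 - m)) := Nat.squarefree_mul_iff.2 ⟨hcop, hm, hw⟩
  refine fundNG_fund_of_mod_four hsq ?_
  obtain ⟨j, rfl⟩ : ∃ j, m = 2 * j + 1 := ⟨m / 2, by omega⟩
  have h : (2 * j + 1) * (4 * c ^ 3 - (2 * j + 1)) + (2 * j + 1) * (2 * j + 1) =
      (2 * j + 1) * (4 * c ^ 3) := by
    rw [← Nat.mul_add, Nat.sub_add_cancel hle]
  have e1 : (2 * j + 1) * (2 * j + 1) = 4 * (j * j + j) + 1 := by ring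
  have e2 : (2 * j + 1) * (4 * c ^ 3) = 4 * ((2 * j + 1) * c ^ 3) := by ring
  omega

/-- Even core: `m` odd, squarefree, coprime to the odd `c`, and `2c³ − m` squarefree ⇒
`−4·m(2c³ − m)` is a negative fundamental discriminant (`m(2c³ − m)` is squarefree and
`= 2c³m − m² ≡ 2 − 1 = 1 (mod 4)`). -/
theorem fundNG_core_even {m c : ℕ} (hm2 : m % 2 = 1) (hc2 : c % 2 = 1) (hm : Squarefree m)
    (hmc : Nat.Coprime m c) (hw : Squarefree (2 * c ^ 3 - m)) :
    IsNegFundamentalDiscr (4 * (m * (2 * c ^ 3 - m))) := by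
  have hle : m ≤ 2 * c ^ 3 := by
    by_contra h
    rw [Nat.sub_eq_zero_of_le (by omega)] at hw
    exact not_squarefree_zero hw
  have hcop : Nat.Coprime m (2 * c ^ 3 - m) := by
    rw [Nat.coprime_sub_self_right hle]
    have h2 : Nat.Coprime m 2 := ((Nat.Prime.coprime_iff_not_dvd Nat.prime_two).2 (by omega)).symm
    exact h2.mul_right (hmc.pow_right 3)
  have hsq : Squarefree (m * (2 * c ^ 3 - m)) := Nat.squarefree_mul_iff.2 ⟨hcop, hm, hw⟩
  refine fundNG_fund_four_mul hsq ?_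
  obtain ⟨j, rfl⟩ : ∃ j, m = 2 * j + 1 := ⟨m / 2, by omega⟩
  obtain ⟨i, hi⟩ : ∃ i, c ^ 3 = 2 * i + 1 :=
    ⟨c ^ 3 / 2, by have := Nat.odd_iff.1 ((Nat.odd_iff.2 hc2).pow (n := 3)); omega⟩
  have h : (2 * j + 1) * (2 * c ^ 3 - (2 * j + 1)) + (2 * j + 1) * (2 * j + 1) =
      (2 * j + 1) * (2 * c ^ 3) := by
    rw [← Nat.mul_add, Nat.sub_add_cancel hle]
  have e1 : (2 * j + 1) * (2 * j + 1) = 4 * (j * j + j) + 1 := by ring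
  have e2 : (2 * j + 1) * (2 * c ^ 3) = 4 * ((2 * j + 1) * i + j) + 2 := by
    rw [hi]
    ring
  omega

/-- Odd modulus: `N` odd squarefree, `gcd(c, N) = 1`, and both `s = 1 + 6cNk` and `4c³ − N s`
squarefree ⇒ `−N s (4c³ − N s)` is a negative fundamental discriminant (`N s` is odd, squarefree as
`s ≡ 1 (mod N)`, and coprime to `c` as `s ≡ 1 (mod c)`). -/
theorem fundNG_fund_odd {N c k : ℕ} (hN : Squarefree N) (hN2 : N % 2 = 1) (hcN : Nat.Coprime c N)
    (hs : Squarefree (1 + 6 * c * N * k))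
    (hw : Squarefree (4 * c ^ 3 - N * (1 + 6 * c * N * k))) :
    IsNegFundamentalDiscr (N * (1 + 6 * c * N * k) * (4 * c ^ 3 - N * (1 + 6 * c * N * k))) := by
  have hs2 : (1 + 6 * c * N * k) % 2 = 1 := by
    have e : 6 * c * N * k = 2 * (3 * c * N * k) := by ring
    omega
  have hNs : Nat.Coprime N (1 + 6 * c * N * k) := by
    rw [show 6 * c * N * k = N * (6 * c * k) by ring]
    exact (Nat.coprime_add_mul_left_right N 1 _).2 (Nat.coprime_one_right N)
  have hsc : Nat.Coprime (1 + 6 * c * N * k) c := by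
    rw [show 6 * c * N * k = c * (6 * N * k) by ring]
    exact (Nat.coprime_add_mul_left_left 1 c _).2 (Nat.coprime_one_left c)
  exact fundNG_core_odd (Nat.odd_iff.1 (Nat.odd_mul.2 ⟨Nat.odd_iff.2 hN2, Nat.odd_iff.2 hs2⟩))
    (Nat.squarefree_mul_iff.2 ⟨hNs, hN, hs⟩) (hcN.symm.mul_left hsc) hw

/-- Even modulus `N = 2M`: `M` odd squarefree, `gcd(c, M) = 1`, `c` odd, and both `s = 1 + 6cNk`
and `2c³ − M s` squarefree ⇒ `−N s (4c³ − N s) = −4·(M s)(2c³ − M s)` is a negative fundamental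
discriminant. -/
theorem fundNG_fund_even {M c k : ℕ} (hM : Squarefree M) (hM2 : M % 2 = 1)
    (hcM : Nat.Coprime c M) (hc2 : c % 2 = 1) (hs : Squarefree (1 + 6 * c * (2 * M) * k))
    (hw : Squarefree (2 * c ^ 3 - M * (1 + 6 * c * (2 * M) * k))) :
    IsNegFundamentalDiscr
      (2 * M * (1 + 6 * c * (2 * M) * k) * (4 * c ^ 3 - 2 * M * (1 + 6 * c * (2 * M) * k))) := by
  generalize hs_def : 1 + 6 * c * (2 * M) * k = s at hs hw ⊢
  have e : 2 * M * s * (4 * c ^ 3 - 2 * M * s) = 4 * (M * s * (2 * c ^ 3 - M * s)) := by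
    have h : 4 * c ^ 3 - 2 * M * s = 2 * (2 * c ^ 3 - M * s) := by
      rw [show 2 * M * s = 2 * (M * s) by ring]; omega
    rw [h]; ring
  rw [e]
  have hs2 : s % 2 = 1 := by
    have h : 6 * c * (2 * M) * k = 2 * (6 * c * M * k) := by ring
    omega
  have hMs : Nat.Coprime M s := by
    rw [← hs_def, show 6 * c * (2 * M) * k = M * (12 * c * k) by ring]
    exact (Nat.coprime_add_mul_left_right M 1 _).2 (Nat.coprime_one_right M)
  have hsc : Nat.Coprime s c := by
    rw [← hs_def, show 6 * c * (2 * M) * k = c * (12 * M * k) by ring]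
    exact (Nat.coprime_add_mul_left_left 1 c _).2 (Nat.coprime_one_left c)
  exact fundNG_core_even (Nat.odd_iff.1 (Nat.odd_mul.2 ⟨Nat.odd_iff.2 hM2, Nat.odd_iff.2 hs2⟩))
    hc2 (Nat.squarefree_mul_iff.2 ⟨hMs, hM, hs⟩) (hcM.symm.mul_left hsc) hw

/-! ## Coprimality of the reflected second progression -/

/-- Second progression: if `b + M = 2ⁱc³` with `M` odd and coprime to `c`, and `b` is odd and
prime to `3`, then `gcd(b, j·c·M²) = 1` for `j ∣ 12` (`gcd(b, M) = gcd(2ⁱc³, M) = 1` and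
`gcd(b, c) ∣ gcd(b, 2ⁱc³) = gcd(b, b + M) = 1`). Used with `(M, i, j) = (N, 2, 6)` for odd `N`
(`b = 4c³ − N`) and `(N/2, 1, 12)` for even `N` (`b = 2c³ − N/2`). -/
theorem fundNG_coprime_aux {M c b i j : ℕ} (hM2 : M % 2 = 1) (hcM : Nat.Coprime c M)
    (hb2 : b % 2 = 1) (hb3 : ¬ 3 ∣ b) (hb : b + M = 2 ^ i * c ^ 3) (hj : j ∣ 12) :
    Nat.Coprime b (j * c * M ^ 2) := by
  have h2 : Nat.Coprime b 2 := ((Nat.Prime.coprime_iff_not_dvd Nat.prime_two).2 (by omega)).symm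
  have h3 : Nat.Coprime b 3 := ((Nat.Prime.coprime_iff_not_dvd Nat.prime_three).2 hb3).symm
  have h2M : Nat.Coprime 2 M := (Nat.Prime.coprime_iff_not_dvd Nat.prime_two).2 (by omega)
  have hbM : Nat.Coprime b M := by
    rw [← Nat.coprime_add_self_left, hb]
    exact (h2M.pow_left i).mul_left (hcM.pow_left 3)
  have hbc : Nat.Coprime b c := by
    have h : Nat.Coprime b (2 ^ i * c ^ 3) := by rw [← hb]; exact Nat.coprime_self_add_right.2 hbM
    exact h.coprime_dvd_right (dvd_mul_of_dvd_right (dvd_pow_self c three_ne_zero) _)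
  have h12 : Nat.Coprime b 12 := (h2.mul_right h2).mul_right h3
  exact ((h12.coprime_dvd_right hj).mul_right hbc).mul_right (hbM.pow_right 2)

/-- Facts about `c = 1 + 2³⁰N⁵`: it is odd, coprime to `N`, and `c³ ≡ 1 + N (mod 3)`
(`2³⁰ ≡ 1`, `N⁵ ≡ N`, `c³ ≡ c (mod 3)`). -/
theorem fundNG_c_facts (N : ℕ) :
    (1 + 2 ^ 30 * N ^ 5) % 2 = 1 ∧ Nat.Coprime (1 + 2 ^ 30 * N ^ 5) N ∧
      (1 + 2 ^ 30 * N ^ 5) ^ 3 % 3 = (1 + N) % 3 := by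
  have hpow : ∀ x : ℕ, x ^ 3 % 3 = x % 3 ∧ x ^ 5 % 3 = x % 3 := by
    intro x
    have h : ∀ r < 3, r ^ 3 % 3 = r ∧ r ^ 5 % 3 = r := by decide
    obtain ⟨h3, h5⟩ := h (x % 3) (Nat.mod_lt x (by norm_num))
    exact ⟨by rw [Nat.pow_mod, h3], by rw [Nat.pow_mod, h5]⟩
  refine ⟨?_, ?_, ?_⟩
  · have e : 2 ^ 30 * N ^ 5 = 2 * (2 ^ 29 * N ^ 5) := by ring
    omega
  · rw [show 2 ^ 30 * N ^ 5 = N * (2 ^ 30 * N ^ 4) by ring]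
    exact (Nat.coprime_add_mul_left_left 1 N _).2 (Nat.coprime_one_left N)
  · have h30 : 2 ^ 30 % 3 = 1 := by norm_num
    rw [(hpow _).1, Nat.add_mod 1, Nat.mul_mod, (hpow N).2, h30]
    omega

/-! ## Counting -/

/-- Reflecting `range K` by `k ↦ K − 1 − k` does not change the number of solutions. -/
theorem fundNG_card_filter_reflect (K : ℕ) (Q : ℕ → Prop) [DecidablePred Q] :
    ((Finset.range K).filter (fun k => Q (K - 1 - k))).card =
      ((Finset.range K).filter Q).card := by
  rw [Finset.card_filter, Finset.card_filter]
  exact Finset.sum_range_reflect (fun k => if Q k then 1 else 0) K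

/-- `x ≤ X²` gives `√x ≤ X`. -/
theorem fundNG_sqrt_le {x X : ℕ} (h : x ≤ X ^ 2) : Nat.sqrt x ≤ X := by
  rw [← Nat.sqrt_eq' X]
  exact Nat.sqrt_le_sqrt h

/-- The counting core. With `K = 16X`, the sieve `stub_apSieve` at `(1, q₁, 5)` and at
`(a₂, q₂, 5)` (`6 ∣ q₁`, `6 ∣ q₂`, `gcd(a₂, q₂) = 1`), a second "bad" progression `g` that is the
reflection of `a₂ + q₂·k`, the square-root bounds `4√(1 + q₁K) ≤ X`, `√(a₂ + q₂K) ≤ X`, and the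
implication `1 + q₁k, g k squarefree ⇒ P k`, at least `K/4` of the `k < K` satisfy `P`:
`4·#P ≥ 4K − (K + X) − (K + 4X) = 27X ≥ K`. -/
theorem fundNG_count {K X q₁ a₂ q₂ : ℕ} {P : ℕ → Prop} [DecidablePred P] (g : ℕ → ℕ)
    (hKX : K = 16 * X) (hq₁ : 0 < q₁) (h6₁ : 6 ∣ q₁) (hq₂ : 0 < q₂) (h6₂ : 6 ∣ q₂)
    (hcop : Nat.Coprime a₂ q₂) (hg : ∀ k < K, g k = a₂ + q₂ * (K - 1 - k))
    (hS1 : 4 * Nat.sqrt (1 + q₁ * K) ≤ X) (hS2 : Nat.sqrt (a₂ + q₂ * K) ≤ X)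
    (himp : ∀ k, Squarefree (1 + q₁ * k) → Squarefree (g k) → P k) :
    K ≤ 4 * ((Finset.range K).filter P).card := by
  have h1 : (5 - 1) * ((Finset.range K).filter (fun k => ¬ Squarefree (1 + q₁ * k))).card ≤
      K + (5 - 1) * Nat.sqrt (1 + q₁ * K) :=
    stub_apSieve 1 q₁ K 5 hq₁ (Nat.coprime_one_left _) (by norm_num)
      (fun p hp hpn => fundAP_five_le hp h6₁ hpn)
  have h2 : (5 - 1) * ((Finset.range K).filter (fun k => ¬ Squarefree (a₂ + q₂ * k))).card ≤
      K + (5 - 1) * Nat.sqrt (a₂ + q₂ * K) :=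
    stub_apSieve a₂ q₂ K 5 hq₂ hcop (by norm_num) (fun p hp hpn => fundAP_five_le hp h6₂ hpn)
  have h3 : K ≤ ((Finset.range K).filter P).card +
      ((Finset.range K).filter (fun k => ¬ Squarefree (1 + q₁ * k))).card +
      ((Finset.range K).filter (fun k => ¬ Squarefree (g k))).card :=
    fundAP_le_card_add himp
  have h4 : ((Finset.range K).filter (fun k => ¬ Squarefree (g k))).card =
      ((Finset.range K).filter (fun k => ¬ Squarefree (a₂ + q₂ * k))).card := by
    rw [← fundNG_card_filter_reflect K (fun k => ¬ Squarefree (a₂ + q₂ * k))]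
    exact congrArg Finset.card
      (Finset.filter_congr (fun k hk => by rw [hg k (Finset.mem_range.1 hk)]))
  omega

/-- Size of the first progression: `c ≤ 2^(5n+30)` and `N ≤ 2^n` give
`4√(1 + 6cN·2^(8n+48)) ≤ 4·2^(7n+41) ≤ 2^(8n+44)`. -/
theorem fundNG_size_one {n c N : ℕ} (hc : c ≤ 2 ^ (5 * n + 30)) (hN : N ≤ 2 ^ n) :
    4 * Nat.sqrt (1 + 6 * c * N * 2 ^ (8 * n + 48)) ≤ 2 ^ (8 * n + 44) := by
  have h1 : Nat.sqrt (1 + 6 * c * N * 2 ^ (8 * n + 48)) ≤ 2 ^ (7 * n + 41) := by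
    apply fundNG_sqrt_le
    have hY : 1 ≤ 2 ^ (14 * n + 78) := Nat.one_le_two_pow
    have h : 6 * c * N * 2 ^ (8 * n + 48) ≤ 6 * 2 ^ (14 * n + 78) := by
      calc 6 * c * N * 2 ^ (8 * n + 48) ≤ 6 * 2 ^ (5 * n + 30) * 2 ^ n * 2 ^ (8 * n + 48) :=
            Nat.mul_le_mul_right _ (Nat.mul_le_mul (Nat.mul_le_mul_left 6 hc) hN)
        _ = 6 * 2 ^ (14 * n + 78) := by ring
    have e : (2 ^ (7 * n + 41)) ^ 2 = 16 * 2 ^ (14 * n + 78) := by ring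
    omega
  calc 4 * Nat.sqrt (1 + 6 * c * N * 2 ^ (8 * n + 48)) ≤ 4 * 2 ^ (7 * n + 41) :=
        Nat.mul_le_mul_left 4 h1
    _ = 2 ^ (7 * n + 43) := by ring
    _ ≤ 2 ^ (8 * n + 44) := Nat.pow_le_pow_right (by norm_num) (by omega)

/-- Size of the second progression: `x ≤ 5c³`, `c ≤ 2^(5n+30)` and `n ≥ 5` give
`√x ≤ 2^(8n+44)` (`5c³ ≤ 2^(15n+93) ≤ 2^(16n+88)`). -/
theorem fundNG_size_two {n c x : ℕ} (hn : 5 ≤ n) (hc : c ≤ 2 ^ (5 * n + 30))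
    (hx : x ≤ 5 * c ^ 3) : Nat.sqrt x ≤ 2 ^ (8 * n + 44) := by
  apply fundNG_sqrt_le
  calc x ≤ 5 * c ^ 3 := hx
    _ ≤ 5 * (2 ^ (5 * n + 30)) ^ 3 := Nat.mul_le_mul_left 5 (Nat.pow_le_pow_left hc 3)
    _ ≤ 8 * (2 ^ (5 * n + 30)) ^ 3 := Nat.mul_le_mul_right _ (by norm_num)
    _ = 2 ^ (15 * n + 93) := by ring
    _ ≤ 2 ^ (16 * n + 88) := Nat.pow_le_pow_right (by norm_num) (by omega)
    _ = (2 ^ (8 * n + 44)) ^ 2 := by ring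

/-! ## The stub -/

/-- **Stub G · `stub_fundDensityNG`** (YES-DENSITY `≥ 1/4`, from the landed `stub_apSieve`): for
squarefree `N` of bit-length `n ≥ 10`, at least a quarter of the seeds `k < 2^{8n+48}` make `−d`,
`d = N s (4c³ − N s)`, `c = 1 + 2³⁰N⁵`, `s = 1 + 6cNk`, a negative fundamental discriminant
(`s` and `4c³ − N s`, resp. `2c³ − (N/2) s` for even `N`, squarefree suffice; two progressions
sieved at `p₀ = 5`, the second one after the reflection `k ↦ K − 1 − k`; residues mod `4`
automatic). -/
theorem stub_fundDensityNG :
    ∃ n₀ : ℕ, ∀ n, n₀ ≤ n → ∀ N : ℕ, Squarefree N → (encodeNat N).length = n →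
      2 ^ (8 * n + 48) ≤ 4 * ((Finset.range (2 ^ (8 * n + 48))).filter (fun k =>
        IsNegFundamentalDiscr (N * (1 + 6 * (1 + 2 ^ 30 * N ^ 5) * N * k) *
          (4 * (1 + 2 ^ 30 * N ^ 5) ^ 3 - N * (1 + 6 * (1 + 2 ^ 30 * N ^ 5) * N * k))))).card := by
  refine ⟨10, fun n hn N hN hlen => ?_⟩
  -- bit length: `2^(n-1) ≤ N < 2^n`
  have hsz : N.size = n := by rwa [← norm_encodeNat, length_norm, bitsToNat_encodeNat] at hlen
  have hNlt : N < 2 ^ n := Nat.size_le.1 hsz.le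
  have hNge : 2 ^ (n - 1) ≤ N := Nat.lt_size.1 (by omega)
  have h2N : 2 ^ n ≤ 2 * N := by
    rw [show n = n - 1 + 1 by omega, pow_succ]
    omega
  have hN0 : 0 < N := lt_of_lt_of_le Nat.one_le_two_pow hNge
  -- the constant `c`
  obtain ⟨hc2, hcN, hc3⟩ := fundNG_c_facts N
  generalize hc : 1 + 2 ^ 30 * N ^ 5 = c at hc2 hcN hc3 ⊢
  have hcge : 2 ^ 30 * N ^ 5 ≤ c := by omega
  have hcle : c ≤ 2 ^ (5 * n + 30) := by
    have h5 : N ^ 5 < (2 ^ n) ^ 5 := Nat.pow_lt_pow_left hNlt (by norm_num)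
    have e : (2 : ℕ) ^ (5 * n + 30) = 2 ^ 30 * (2 ^ n) ^ 5 := by ring
    omega
  have hB : 8 * N ≤ c :=
    le_trans (Nat.mul_le_mul (by norm_num) (Nat.le_self_pow (by norm_num) N)) hcge
  have hC : c ≤ c ^ 3 := Nat.le_self_pow (by norm_num) c
  have hc0 : 0 < c := by omega
  -- `K = 16 X` and no truncation: `2 (N + 6 c N² K) ≤ c³`
  have hKX : 2 ^ (8 * n + 48) = 16 * 2 ^ (8 * n + 44) := by ring
  have hK1 : 1 ≤ 2 ^ (8 * n + 48) := Nat.one_le_two_pow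
  have hKN : 2 ^ (8 * n + 48) ≤ 2 ^ 56 * N ^ 8 := by
    calc 2 ^ (8 * n + 48) = 2 ^ 48 * (2 ^ n) ^ 8 := by ring
      _ ≤ 2 ^ 48 * (2 * N) ^ 8 := Nat.mul_le_mul_left _ (Nat.pow_le_pow_left h2N 8)
      _ = 2 ^ 56 * N ^ 8 := by ring
  have hA : 16 * (6 * c * N ^ 2 * 2 ^ (8 * n + 48)) ≤ 6 * c ^ 3 := by
    calc 16 * (6 * c * N ^ 2 * 2 ^ (8 * n + 48)) ≤ 16 * (6 * c * N ^ 2 * (2 ^ 56 * N ^ 8)) :=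
          Nat.mul_le_mul_left _ (Nat.mul_le_mul_left _ hKN)
      _ = 6 * c * (2 ^ 30 * N ^ 5) ^ 2 := by ring
      _ ≤ 6 * c * c ^ 2 := Nat.mul_le_mul_left _ (Nat.pow_le_pow_left hcge 2)
      _ = 6 * c ^ 3 := by ring
  have hbig : 2 * (N + 6 * c * N ^ 2 * 2 ^ (8 * n + 48)) ≤ c ^ 3 := by omega
  -- the first progression `s = 1 + 6 c N k`
  have hS1 : 4 * Nat.sqrt (1 + 6 * c * N * 2 ^ (8 * n + 48)) ≤ 2 ^ (8 * n + 44) :=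
    fundNG_size_one hcle hNlt.le
  have h6q₁ : 6 ∣ 6 * c * N := (dvd_mul_right 6 c).mul_right N
  have hq₁ : 0 < 6 * c * N := Nat.mul_pos (Nat.mul_pos (by norm_num) hc0) hN0
  obtain ⟨M, hM | hM⟩ := Nat.even_or_odd' N
  · -- even modulus `N = 2M`, `M` odd and squarefree
    subst hM
    have hM2 : M % 2 = 1 := by
      by_contra h
      exact absurd (Nat.isUnit_iff.1 (hN 2 ⟨M / 2, by omega⟩)) (by norm_num)
    have hMsq : Squarefree M := hN.squarefree_of_dvd (dvd_mul_left M 2)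
    have hcM : Nat.Coprime c M := hcN.coprime_mul_left_right
    have hqK : 12 * c * M ^ 2 * (2 ^ (8 * n + 48) - 1) =
        12 * c * M ^ 2 * 2 ^ (8 * n + 48) - 12 * c * M ^ 2 := Nat.mul_sub_one _ _
    have hqle : 12 * c * M ^ 2 ≤ 12 * c * M ^ 2 * 2 ^ (8 * n + 48) :=
      Nat.le_mul_of_pos_right _ hK1
    have e : 6 * c * (2 * M) ^ 2 * 2 ^ (8 * n + 48) = 2 * (12 * c * M ^ 2 * 2 ^ (8 * n + 48)) := by
      ring
    obtain ⟨a₂, ha₂⟩ : ∃ a₂, a₂ + 12 * c * M ^ 2 * (2 ^ (8 * n + 48) - 1) + M = 2 * c ^ 3 :=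
      ⟨2 * c ^ 3 - M - 12 * c * M ^ 2 * (2 ^ (8 * n + 48) - 1), by omega⟩
    refine fundNG_count (fun k => 2 * c ^ 3 - M * (1 + 6 * c * (2 * M) * k)) hKX hq₁ h6q₁
      (q₂ := 12 * c * M ^ 2) (a₂ := a₂)
      (Nat.mul_pos (Nat.mul_pos (by norm_num) hc0) (Nat.pow_pos (by omega)))
      (Dvd.intro (2 * c * M ^ 2) (by ring)) ?_ ?_ hS1 ?_
      (fun k hs hw => fundNG_fund_even hMsq hM2 hcM hc2 hs hw)
    · have hb : a₂ + 12 * c * M ^ 2 * (2 ^ (8 * n + 48) - 1) + M = 2 ^ 1 * c ^ 3 := by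
        rw [ha₂, pow_one]
      exact (Nat.coprime_add_mul_left_left a₂ _ _).1
        (fundNG_coprime_aux hM2 hcM (by omega) (by omega) hb (dvd_refl 12))
    · intro k hk
      have e1 : M * (1 + 6 * c * (2 * M) * k) = M + 12 * c * M ^ 2 * k := by ring
      have e2 : 12 * c * M ^ 2 * (2 ^ (8 * n + 48) - 1 - k) + 12 * c * M ^ 2 * k =
          12 * c * M ^ 2 * (2 ^ (8 * n + 48) - 1) := by
        rw [← Nat.mul_add, Nat.sub_add_cancel (by omega)]
      rw [e1]
      omega
    · apply fundNG_size_two (by omega) hcle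
      have hq : 12 * c * M ^ 2 ≤ c ^ 3 :=
        calc 12 * c * M ^ 2 ≤ c * (8 * (2 * M)) ^ 2 := by ring_nf; omega
          _ ≤ c * c ^ 2 := Nat.mul_le_mul_left c (Nat.pow_le_pow_left hB 2)
          _ = c ^ 3 := by ring
      omega
  · -- odd modulus
    have hN2 : N % 2 = 1 := by omega
    have hqK : 6 * c * N ^ 2 * (2 ^ (8 * n + 48) - 1) =
        6 * c * N ^ 2 * 2 ^ (8 * n + 48) - 6 * c * N ^ 2 := Nat.mul_sub_one _ _
    have hqle : 6 * c * N ^ 2 ≤ 6 * c * N ^ 2 * 2 ^ (8 * n + 48) :=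
      Nat.le_mul_of_pos_right _ hK1
    obtain ⟨a₂, ha₂⟩ : ∃ a₂, a₂ + 6 * c * N ^ 2 * (2 ^ (8 * n + 48) - 1) + N = 4 * c ^ 3 :=
      ⟨4 * c ^ 3 - N - 6 * c * N ^ 2 * (2 ^ (8 * n + 48) - 1), by omega⟩
    refine fundNG_count (fun k => 4 * c ^ 3 - N * (1 + 6 * c * N * k)) hKX hq₁ h6q₁
      (q₂ := 6 * c * N ^ 2) (a₂ := a₂)
      (Nat.mul_pos (Nat.mul_pos (by norm_num) hc0) (Nat.pow_pos hN0))
      (Dvd.intro (c * N ^ 2) (by ring)) ?_ ?_ hS1 ?_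
      (fun k hs hw => fundNG_fund_odd hN hN2 hcN hs hw)
    · have hb : a₂ + 6 * c * N ^ 2 * (2 ^ (8 * n + 48) - 1) + N = 2 ^ 2 * c ^ 3 := by
        rw [ha₂]; norm_num
      exact (Nat.coprime_add_mul_left_left a₂ _ _).1
        (fundNG_coprime_aux hN2 hcN (by omega) (by omega) hb (by norm_num))
    · intro k hk
      have e1 : N * (1 + 6 * c * N * k) = N + 6 * c * N ^ 2 * k := by ring
      have e2 : 6 * c * N ^ 2 * (2 ^ (8 * n + 48) - 1 - k) + 6 * c * N ^ 2 * k =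
          6 * c * N ^ 2 * (2 ^ (8 * n + 48) - 1) := by
        rw [← Nat.mul_add, Nat.sub_add_cancel (by omega)]
      rw [e1]
      omega
    · apply fundNG_size_two (by omega) hcle
      have hq : 6 * c * N ^ 2 ≤ c ^ 3 :=
        calc 6 * c * N ^ 2 ≤ c * (8 * N) ^ 2 := by ring_nf; omega
          _ ≤ c * c ^ 2 := Nat.mul_le_mul_left c (Nat.pow_le_pow_left hB 2)
          _ = c ^ 3 := by ring
      omega

end Summit.QuantumAdvantage.QuantumAdvantage.Theorems.IqThreeNotPPoly
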